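import Summits.CriticalPhenomena.CardyFormulaZ2.Theses.CardySelfRefinement
import Summits.CriticalPhenomena.CardyFormulaZ2.Theorems.CardySelfRefinementLagHandOffDiscreteSplittingGeometry
import Summits.CriticalPhenomena.CardyFormulaZ2.Theorems.CardySelfRefinementLagHandOffDiscreteSplittingPatch
import Summits.CriticalPhenomena.CardyFormulaZ2.Theorems.CardySelfRefinementLagHandOffDiscreteSplittingLabels
import Summits.CriticalPhenomena.CardyFormulaZ2.Theorems.CardySelfRefinementLagHandOffDiscreteSplittingOfLabelling
import Summits.CriticalPhenomena.CardyFormulaZ2.Theorems.CardySelfRefinementLagHandOffDiscreteSplittingMesh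
import HarnessLib

/-!
# Exact lattice target independence: stub `stub_discreteSplitting` (R3b) of line `hitting-tournament`
for crux `LagHandOff` (stmt-CriticalPhenomena-10268)

`stub_discreteSplitting`: the two chords `(D; x₀, x₁)` and `(D; x₀, x₂)` of a `3`-marked Jordan
domain carry admissible `ℤ²`-discretisation families `E₁`, `E₂` whose bond-percolation interfaces,
at every small mesh and for EVERY configuration, coincide or share a common parametrised prefix
ending `ρ`-close to the arc `[x₁, x₂] = D.arc 1`.

PROOF.  `splitting_families` (this file; registered sub-goal `stub_discreteSplitting_families`):
from the tree theorem `eventually_labelling` applied to the chords `(x₀, x₂)` and `(x₁, x₂)` at a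
common diagonal tolerance `ε δ → 0` (`splitting_labels`, `…DiscreteSplittingLabels.lean`), the
labelling for `(x₀, x₂)` is PATCHED into one for `(x₀, x₁)` by relabelling `A ↦ B` on the sites of
the `(x₁, x₂)`-labelling's `A`-class and on the `λ`-neighbourhood of `x₂`; pure lattice
combinatorics (`splitting_patch`, `…DiscreteSplittingPatch.lean`, with the metric geometry of the
three arcs, `…DiscreteSplittingGeometry.lean`) shows that the patched labelling is again
admissible with exactly the cut edges `e_a` (shared, near `x₀`) and `e₁` (near `x₁`), and lead-0's
marker reduction with identified arcs (`zdDiscretisationFamily_of_labelling_arcs`,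
`…DiscreteSplittingOfLabelling.lean`) turns both labellings into families with identified discrete
arcs: nested (`A(E₁) ⊆ A(E₂)`, `B(E₂) ⊆ B(E₁)`), sharing `e_a`, the relabelled sites `ε δ`-close
to `[x₁, x₂]`.  `splitting_at_mesh` (`…DiscreteSplittingMesh.lean`): at such a mesh the two
completed configurations of ANY `ω` agree off the relabelled sites, the start corner (or, for a
positively oriented loop, the end corner) at `e_a` is common, and lead-0's deterministic prefix /
suffix theorems (`bondInterfaceIn_eq_or_commonPrefix`, `…_rev`) give equality or a common
parametrised prefix ending within `ε δ + 3δ/2 ≤ ρ` of `[x₁, x₂]`.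
-/

noncomputable section

open MeasureTheory Filter Set Topology Metric
open scoped unitInterval BoundedContinuousFunction
open Literature.Probability.Percolation Literature.Probability.LatticeModels
open Literature.Probability.RandomPlanarGeometry Literature.Probability.Percolation.QuadCrossing

namespace Summit.CriticalPhenomena.CardyFormulaZ2.Cruxes.LagHandOff.HittingTournament


/-- Distance to a union of two compact nonempty sets: one of the two is as close. -/
theorem infDist_le_or_of_union {s t : Set ℂ} (hs : IsCompact s) (ht : IsCompact t) (hsn : s.Nonempty)
    {x : ℂ} {r : ℝ} (h : infDist x (s ∪ t) ≤ r) : infDist x s ≤ r ∨ infDist x t ≤ r := by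
  obtain ⟨z, hz, hzd⟩ := (hs.union ht).exists_infDist_eq_dist (hsn.mono subset_union_left) x
  rcases hz with hz | hz
  · exact Or.inl ((infDist_le_dist_of_mem hz).trans (hzd ▸ h))
  · exact Or.inr ((infDist_le_dist_of_mem hz).trans (hzd ▸ h))

/-- The Hausdorff distance between the midpoints of two edges and two points they are close to. -/
theorem hausdorffEDist_pair_le {δ r : ℝ} {ea e1 : Sym2 (Site 2)} {a b : ℂ}
    (ha : dist (medialPoint δ ea) a ≤ r) (hb : dist (medialPoint δ e1) b ≤ r) :
    hausdorffEDist (medialPoint δ '' {ea, e1}) {a, b} ≤ ENNReal.ofReal r := by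
  rw [image_pair]
  have hed : ∀ {x y : ℂ}, dist x y ≤ r → edist x y ≤ ENNReal.ofReal r := fun h => by
    rw [edist_dist]; exact ENNReal.ofReal_le_ofReal h
  refine hausdorffEDist_le_of_mem_edist ?_ ?_
  · rintro x (rfl | rfl)
    · exact ⟨a, Or.inl rfl, hed ha⟩
    · exact ⟨b, Or.inr rfl, hed hb⟩
  · rintro y (rfl | rfl)
    · exact ⟨_, Or.inl rfl, by rw [edist_comm]; exact hed ha⟩
    · exact ⟨_, Or.inr rfl, by rw [edist_comm]; exact hed hb⟩

set_option maxHeartbeats 3200000 in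
/-- **The patched labelling at one good mesh.** From the two labellings of `splitting_labels` at a
mesh `δ` and tolerance `ε` small against the geometry of `(D; x₀, x₁, x₂)`, the patched labels
`S₀ = SA ∩ SB' ∖ (λ-ball at x₂)`, `T = ∂Ω_δ ∖ S₀` have the ten properties for the chord `(x₀, x₁)`
at tolerance `2ε`, cut midpoints within `2ε` of `{x₀, x₁}`, are nested in the labels for
`(x₀, x₂)` with the relabelled sites `2ε`-close to `[x₁, x₂]`, and the cut edges are identified. -/
theorem patch_at_mesh (D : MarkedDomain 3) {δ ε lam θ μ : ℝ} (hδ : 0 < δ) (hε : 0 < ε)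
    {SA SB SA' SB' S0 T : Set (Site 2)}
    (h₂ : (SA ∪ SB = (⟨D.carrier, δ, ∅, ∅⟩ : DiscreteDobrushin).zdBoundary ∧
        Disjoint SA SB ∧ SA.Nonempty ∧ SB.Nonempty ∧
        (∀ y ∈ SA, ¬ closedBall (meshPoint δ y) (infDist (meshPoint δ y) (frontier D.carrier)) ⊆
          ⋃ x ∈ SB, closedBall (meshPoint δ x) (infDist (meshPoint δ x) (frontier D.carrier))) ∧
        (∀ x ∈ SB, ¬ closedBall (meshPoint δ x) (infDist (meshPoint δ x) (frontier D.carrier)) ⊆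
          ⋃ y ∈ SA, closedBall (meshPoint δ y) (infDist (meshPoint δ y) (frontier D.carrier))) ∧
        (∀ y ∈ SA, infDist (meshPoint δ y) ((D.chord 0 2 (by decide)).arc 0) ≤ ε) ∧
        (∀ x ∈ SB, infDist (meshPoint δ x) ((D.chord 0 2 (by decide)).arc 1) ≤ ε) ∧
        {e | e ∈ (discreteDomainGraph D.carrier δ).edgeSet ∧ (∃ x ∈ e, x ∈ SA) ∧
          ∃ y ∈ e, y ∈ SB}.ncard = 2 ∧
        ∀ e ∈ (discreteDomainGraph D.carrier δ).edgeSet, (∃ x ∈ e, x ∈ SA) → (∃ y ∈ e, y ∈ SB) →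
          ∃! f, (⟨D.carrier, δ, ∅, ∅⟩ : DiscreteDobrushin).IsInnerFace f ∧ ∀ x ∈ e, IsCorner x f) ∧
      hausdorffEDist (medialPoint δ ''
        {e | e ∈ (discreteDomainGraph D.carrier δ).edgeSet ∧ (∃ x ∈ e, x ∈ SA) ∧
          ∃ y ∈ e, y ∈ SB}) {D.pt 0, D.pt 2} ≤ ENNReal.ofReal ε)
    (h₃ : (SA' ∪ SB' = (⟨D.carrier, δ, ∅, ∅⟩ : DiscreteDobrushin).zdBoundary ∧
        Disjoint SA' SB' ∧ SA'.Nonempty ∧ SB'.Nonempty ∧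
        (∀ y ∈ SA', ¬ closedBall (meshPoint δ y) (infDist (meshPoint δ y) (frontier D.carrier)) ⊆
          ⋃ x ∈ SB', closedBall (meshPoint δ x) (infDist (meshPoint δ x) (frontier D.carrier))) ∧
        (∀ x ∈ SB', ¬ closedBall (meshPoint δ x) (infDist (meshPoint δ x) (frontier D.carrier)) ⊆
          ⋃ y ∈ SA', closedBall (meshPoint δ y) (infDist (meshPoint δ y) (frontier D.carrier))) ∧
        (∀ y ∈ SA', infDist (meshPoint δ y) ((D.chord 1 2 (by decide)).arc 0) ≤ ε) ∧
        (∀ x ∈ SB', infDist (meshPoint δ x) ((D.chord 1 2 (by decide)).arc 1) ≤ ε) ∧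
        {e | e ∈ (discreteDomainGraph D.carrier δ).edgeSet ∧ (∃ x ∈ e, x ∈ SA') ∧
          ∃ y ∈ e, y ∈ SB'}.ncard = 2 ∧
        ∀ e ∈ (discreteDomainGraph D.carrier δ).edgeSet, (∃ x ∈ e, x ∈ SA') → (∃ y ∈ e, y ∈ SB') →
          ∃! f, (⟨D.carrier, δ, ∅, ∅⟩ : DiscreteDobrushin).IsInnerFace f ∧ ∀ x ∈ e, IsCorner x f) ∧
      hausdorffEDist (medialPoint δ ''
        {e | e ∈ (discreteDomainGraph D.carrier δ).edgeSet ∧ (∃ x ∈ e, x ∈ SA') ∧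
          ∃ y ∈ e, y ∈ SB'}) {D.pt 1, D.pt 2} ≤ ENNReal.ofReal ε)
    (hθ : ∀ z : ℂ, infDist z (D.arc 1) ≤ θ → infDist z (D.arc 2) ≤ θ → dist z (D.pt 2) < lam)
    (hμ : ∀ z : ℂ, infDist z (D.arc 0) ≤ μ → infDist z (D.arc 1) ≤ μ → infDist z (D.arc 2) ≤ μ → False)
    (hlam : lam ≤ infDist (D.pt 2) (D.arc 0) / 2 ∧ lam ≤ dist (D.pt 0) (D.pt 2) / 2 ∧
      lam ≤ dist (D.pt 1) (D.pt 2) / 2)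
    (hsmall : 2 * ε + 4 * δ < min θ (min μ (min (infDist (D.pt 2) (D.arc 0) / 2)
      (min (infDist (D.pt 0) (D.arc 1) / 2) (min (infDist (D.pt 1) (D.arc 2) / 2)
      (min (dist (D.pt 0) (D.pt 2) / 2) (min (dist (D.pt 1) (D.pt 2) / 2) lam)))))))
    (hS0 : S0 = {y | y ∈ SA ∧ y ∈ SB' ∧ lam ≤ dist (meshPoint δ y) (D.pt 2)})
    (hT : T = (⟨D.carrier, δ, ∅, ∅⟩ : DiscreteDobrushin).zdBoundary \ S0) :
    (S0 ∪ T = (⟨D.carrier, δ, ∅, ∅⟩ : DiscreteDobrushin).zdBoundary ∧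
      Disjoint S0 T ∧ S0.Nonempty ∧ T.Nonempty ∧
      (∀ y ∈ S0, ¬ closedBall (meshPoint δ y) (infDist (meshPoint δ y) (frontier D.carrier)) ⊆
        ⋃ x ∈ T, closedBall (meshPoint δ x) (infDist (meshPoint δ x) (frontier D.carrier))) ∧
      (∀ x ∈ T, ¬ closedBall (meshPoint δ x) (infDist (meshPoint δ x) (frontier D.carrier)) ⊆
        ⋃ y ∈ S0, closedBall (meshPoint δ y) (infDist (meshPoint δ y) (frontier D.carrier))) ∧
      (∀ y ∈ S0, infDist (meshPoint δ y) ((D.chord 0 1 (by decide)).arc 0) ≤ 2 * ε) ∧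
      (∀ x ∈ T, infDist (meshPoint δ x) ((D.chord 0 1 (by decide)).arc 1) ≤ 2 * ε) ∧
      {e | e ∈ (discreteDomainGraph D.carrier δ).edgeSet ∧ (∃ x ∈ e, x ∈ S0) ∧
        ∃ y ∈ e, y ∈ T}.ncard = 2 ∧
      ∀ e ∈ (discreteDomainGraph D.carrier δ).edgeSet, (∃ x ∈ e, x ∈ S0) → (∃ y ∈ e, y ∈ T) →
        ∃! f, (⟨D.carrier, δ, ∅, ∅⟩ : DiscreteDobrushin).IsInnerFace f ∧ ∀ x ∈ e, IsCorner x f) ∧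
    hausdorffEDist (medialPoint δ ''
      {e | e ∈ (discreteDomainGraph D.carrier δ).edgeSet ∧ (∃ x ∈ e, x ∈ S0) ∧
        ∃ y ∈ e, y ∈ T}) {D.pt 0, D.pt 1} ≤ ENNReal.ofReal (2 * ε) ∧
    S0 ⊆ SA ∧ SB ⊆ T ∧ (∀ y ∈ SA, y ∉ S0 → infDist (meshPoint δ y) (D.arc 1) ≤ 2 * ε) ∧
    ∃ ea eb e1 : Sym2 (Site 2),
      {e | e ∈ (discreteDomainGraph D.carrier δ).edgeSet ∧ (∃ x ∈ e, x ∈ SA) ∧ ∃ y ∈ e, y ∈ SB} =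
        {ea, eb} ∧
      {e | e ∈ (discreteDomainGraph D.carrier δ).edgeSet ∧ (∃ x ∈ e, x ∈ S0) ∧ ∃ y ∈ e, y ∈ T} =
        {ea, e1} ∧
      dist (medialPoint δ ea) (D.pt 0) ≤ 2 * ε ∧ dist (medialPoint δ eb) (D.pt 2) ≤ 2 * ε ∧
      dist (medialPoint δ e1) (D.pt 1) ≤ 2 * ε := by
  obtain ⟨⟨c1, c2, c3, c4, c5, c6, c7, c8, c9, c10⟩, hH⟩ := h₂
  obtain ⟨⟨c1', c2', c3', c4', c5', c6', c7', c8', c9', c10'⟩, hH'⟩ := h₃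
  obtain ⟨h02, h02'⟩ := arc_chord_zero_two D
  obtain ⟨h12, h12'⟩ := arc_chord_one_two D
  obtain ⟨h01, h01'⟩ := arc_chord_zero_one D
  have hne : ∀ i, (D.arc i).Nonempty := fun i => ⟨_, D.pt_mem_arc_self i⟩
  have hcp : ∀ i, IsCompact (D.arc i) := fun i => D.isCompact_arc i
  -- unpacking the smallness
  set s := 2 * ε + 4 * δ with hs
  have hsθ : s < θ := hsmall.trans_le (min_le_left _ _)
  have hsμ : s < μ := hsmall.trans_le ((min_le_right _ _).trans (min_le_left _ _))
  have hs2 : s < infDist (D.pt 2) (D.arc 0) / 2 :=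
    hsmall.trans_le ((min_le_right _ _).trans ((min_le_right _ _).trans (min_le_left _ _)))
  have hs0 : s < infDist (D.pt 0) (D.arc 1) / 2 :=
    hsmall.trans_le ((min_le_right _ _).trans ((min_le_right _ _).trans ((min_le_right _ _).trans
      (min_le_left _ _))))
  have hs1 : s < infDist (D.pt 1) (D.arc 2) / 2 :=
    hsmall.trans_le ((min_le_right _ _).trans ((min_le_right _ _).trans ((min_le_right _ _).trans
      ((min_le_right _ _).trans (min_le_left _ _)))))
  have hs02 : s < dist (D.pt 0) (D.pt 2) / 2 :=
    hsmall.trans_le ((min_le_right _ _).trans ((min_le_right _ _).trans ((min_le_right _ _).trans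
      ((min_le_right _ _).trans ((min_le_right _ _).trans (min_le_left _ _))))))
  have hs12 : s < dist (D.pt 1) (D.pt 2) / 2 :=
    hsmall.trans_le ((min_le_right _ _).trans ((min_le_right _ _).trans ((min_le_right _ _).trans
      ((min_le_right _ _).trans ((min_le_right _ _).trans ((min_le_right _ _).trans (min_le_left _ _)))))))
  have hslam : s < lam :=
    hsmall.trans_le ((min_le_right _ _).trans ((min_le_right _ _).trans ((min_le_right _ _).trans
      ((min_le_right _ _).trans ((min_le_right _ _).trans ((min_le_right _ _).trans (min_le_right _ _)))))))
  obtain ⟨hl2, hl02, hl12⟩ := hlam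
  -- the two cut-edge pairs
  have hlt : ENNReal.ofReal ε < ENNReal.ofReal (2 * ε) := (ENNReal.ofReal_lt_ofReal_iff (by linarith)).2 (by linarith)
  obtain ⟨ea, eb, hAB, -, hea, heb⟩ := exists_pair_of_hausdorffEDist_lt c9 (a := D.pt 0) (b := D.pt 2)
    (by linarith) (hH.trans_lt hlt)
  obtain ⟨e1, eb', hAB', -, he1, heb'⟩ := exists_pair_of_hausdorffEDist_lt c9' (a := D.pt 1) (b := D.pt 2)
    (by linarith) (hH'.trans_lt hlt)
  -- sides in terms of the three arcs
  have hsA : ∀ y ∈ SA, infDist (meshPoint δ y) (D.arc 0) ≤ 2 * ε ∨ infDist (meshPoint δ y) (D.arc 1) ≤ 2 * ε := by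
    intro y hy
    have h := c7 y hy
    rw [h02] at h
    exact infDist_le_or_of_union (hcp 0) (hcp 1) (hne 0) (h.trans (by linarith))
  have hsB : ∀ x ∈ SB, infDist (meshPoint δ x) (D.arc 2) ≤ 2 * ε := by
    intro x hx
    have h := c8 x hx
    rw [h02'] at h
    linarith
  have hsA' : ∀ y ∈ SA', infDist (meshPoint δ y) (D.arc 1) ≤ 2 * ε := by
    intro y hy
    have h := c7' y hy
    rw [h12] at h
    linarith
  have hsB' : ∀ x ∈ SB', infDist (meshPoint δ x) (D.arc 2) ≤ 2 * ε ∨ infDist (meshPoint δ x) (D.arc 0) ≤ 2 * ε := by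
    intro x hx
    have h := c8' x hx
    rw [h12'] at h
    exact infDist_le_or_of_union (hcp 2) (hcp 0) (hne 2) (h.trans (by linarith))
  -- the patch
  obtain ⟨⟨p1, p2, p3, p4, p5, p6, p7, p8, p9, p10⟩, hS0A, hSBT, hΔ⟩ := splitting_patch D hδ c1 c2 c5 c6 hsA hsB
    hAB hea.le heb.le c1' c2' c5' c6' hsA' hsB' hAB' he1.le heb'.le
    (fun z h1 h2 => hθ z (by linarith) (by linarith))
    (fun z h0 h1 h2 => hμ z (by linarith) (by linarith) (by linarith))
    (by linarith) (by linarith) (by linarith) (by linarith) (by linarith) (by linarith) hS0 hT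
  -- inner faces of the two cut edges, from the two given labellings
  have hea_mem : ea ∈ {e | e ∈ (discreteDomainGraph D.carrier δ).edgeSet ∧ (∃ x ∈ e, x ∈ SA) ∧
      ∃ y ∈ e, y ∈ SB} := by rw [hAB]; exact Or.inl rfl
  have he1_mem : e1 ∈ {e | e ∈ (discreteDomainGraph D.carrier δ).edgeSet ∧ (∃ x ∈ e, x ∈ SA') ∧
      ∃ y ∈ e, y ∈ SB'} := by rw [hAB']; exact Or.inl rfl
  have hinner : ∀ e ∈ (discreteDomainGraph D.carrier δ).edgeSet, (∃ x ∈ e, x ∈ S0) → (∃ y ∈ e, y ∈ T) →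
      ∃! f, (⟨D.carrier, δ, ∅, ∅⟩ : DiscreteDobrushin).IsInnerFace f ∧ ∀ x ∈ e, IsCorner x f := by
    intro e he hx hy
    have hmem : e ∈ ({ea, e1} : Set (Sym2 (Site 2))) := by rw [← p9]; exact ⟨he, hx, hy⟩
    rcases hmem with rfl | rfl
    · exact c10 _ hea_mem.1 hea_mem.2.1 hea_mem.2.2
    · exact c10' _ he1_mem.1 he1_mem.2.1 he1_mem.2.2
  refine ⟨⟨p1, p2, p3, p4, p5, p6, fun y hy => ?_, fun x hx => ?_, by rw [p9, ncard_pair p10], hinner⟩,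
    ?_, hS0A, hSBT, hΔ, ea, eb, e1, hAB, p9, hea.le, heb.le, he1.le⟩
  · rw [h01]; exact p7 y hy
  · rw [h01']
    rcases p8 x hx with h | h
    · exact (infDist_le_infDist_of_subset subset_union_left (hne 1)).trans h
    · exact (infDist_le_infDist_of_subset subset_union_right (hne 2)).trans h
  · rw [p9]; exact hausdorffEDist_pair_le hea.le he1.le

set_option maxHeartbeats 3200000 in
/-- **Two compatible admissible families.** See the module docstring. -/
theorem splitting_families (D : MarkedDomain 3) :
    ∃ (A₁ B₁ A₂ B₂ : ℝ → Set ℂ) (ε : ℝ → ℝ),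
      ZdDiscretisationFamily (D.chord 0 1 (by decide))
        (fun δ => (⟨D.carrier, δ, A₁ δ, B₁ δ⟩ : DiscreteDobrushin)) ∧
      ZdDiscretisationFamily (D.chord 0 2 (by decide))
        (fun δ => (⟨D.carrier, δ, A₂ δ, B₂ δ⟩ : DiscreteDobrushin)) ∧
      Tendsto ε (𝓝[>] 0) (𝓝 0) ∧
      ∀ᶠ δ in 𝓝[>] (0 : ℝ),
        (⟨D.carrier, δ, A₁ δ, B₁ δ⟩ : DiscreteDobrushin).zdArcA ⊆
          (⟨D.carrier, δ, A₂ δ, B₂ δ⟩ : DiscreteDobrushin).zdArcA ∧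
        (⟨D.carrier, δ, A₂ δ, B₂ δ⟩ : DiscreteDobrushin).zdArcB ⊆
          (⟨D.carrier, δ, A₁ δ, B₁ δ⟩ : DiscreteDobrushin).zdArcB ∧
        (∀ y ∈ (⟨D.carrier, δ, A₂ δ, B₂ δ⟩ : DiscreteDobrushin).zdArcA,
          y ∉ (⟨D.carrier, δ, A₁ δ, B₁ δ⟩ : DiscreteDobrushin).zdArcA →
            infDist (meshPoint δ y) (D.arc 1) ≤ ε δ) ∧
        ∃ ea eb e1 : Sym2 (Site 2),
          (⟨D.carrier, δ, A₂ δ, B₂ δ⟩ : DiscreteDobrushin).zdABEdges = {ea, eb} ∧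
          (⟨D.carrier, δ, A₁ δ, B₁ δ⟩ : DiscreteDobrushin).zdABEdges = {ea, e1} ∧
          dist (medialPoint δ ea) (D.pt 0) ≤ ε δ ∧ dist (medialPoint δ eb) (D.pt 2) ≤ ε δ ∧
          dist (medialPoint δ e1) (D.pt 1) ≤ ε δ := by
  obtain ⟨SA, SB, SA', SB', ε, hε, hlab⟩ := splitting_labels D
  -- geometry of the three arcs
  obtain ⟨hd0, hd1, hd2⟩ := infDist_pt_arc_pos D
  have hx02 : 0 < dist (D.pt 0) (D.pt 2) := dist_pos.2 (D.pt_injective.ne (by decide))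
  have hx12 : 0 < dist (D.pt 1) (D.pt 2) := dist_pos.2 (D.pt_injective.ne (by decide))
  set lam := min (infDist (D.pt 2) (D.arc 0) / 2) (min (dist (D.pt 0) (D.pt 2) / 2) (dist (D.pt 1) (D.pt 2) / 2))
    with hlam
  have hlam0 : 0 < lam := lt_min (by linarith) (lt_min (by linarith) (by linarith))
  have hlam' : lam ≤ infDist (D.pt 2) (D.arc 0) / 2 ∧ lam ≤ dist (D.pt 0) (D.pt 2) / 2 ∧
      lam ≤ dist (D.pt 1) (D.pt 2) / 2 :=
    ⟨min_le_left _ _, (min_le_right _ _).trans (min_le_left _ _), (min_le_right _ _).trans (min_le_right _ _)⟩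
  obtain ⟨μ, hμ, hthree⟩ := exists_not_near_three_arcs D
  obtain ⟨θ, hθ, htwo⟩ := exists_near_pt_two_of_near_arcs D hlam0
  set c := min θ (min μ (min (infDist (D.pt 2) (D.arc 0) / 2)
      (min (infDist (D.pt 0) (D.arc 1) / 2) (min (infDist (D.pt 1) (D.arc 2) / 2)
      (min (dist (D.pt 0) (D.pt 2) / 2) (min (dist (D.pt 1) (D.pt 2) / 2) lam)))))) with hc
  have hc0 : 0 < c := by positivity
  -- smallness for all small meshes
  have hsmall : ∀ᶠ δ in 𝓝[>] (0 : ℝ), 2 * ε δ + 4 * δ < c := by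
    have h1 : Tendsto (fun δ : ℝ => 2 * ε δ + 4 * δ) (𝓝[>] 0) (𝓝 0) := by
      have hδ : Tendsto (fun δ : ℝ => δ) (𝓝[>] (0 : ℝ)) (𝓝 0) := tendsto_nhdsWithin_of_tendsto_nhds tendsto_id
      simpa using (hε.const_mul 2).add (hδ.const_mul 4)
    exact h1.eventually (gt_mem_nhds hc0)
  -- the patched labels for the chord `(x₀, x₁)`
  set S0 : ℝ → Set (Site 2) := fun δ => {y | y ∈ SA δ ∧ y ∈ SB' δ ∧ lam ≤ dist (meshPoint δ y) (D.pt 2)}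
    with hS0
  set T : ℝ → Set (Site 2) := fun δ => (⟨D.carrier, δ, ∅, ∅⟩ : DiscreteDobrushin).zdBoundary \ S0 δ with hT
  set e : ℝ → ℝ := fun δ => 2 * ε δ with he
  have het : Tendsto e (𝓝[>] 0) (𝓝 0) := by simpa using hε.const_mul 2
  have hδpos : ∀ᶠ δ in 𝓝[>] (0 : ℝ), 0 < δ := self_mem_nhdsWithin
  have hgood := (hδpos.and (hlab.and hsmall)).mono fun δ h =>
    patch_at_mesh D h.1 h.2.1.1 (S0 := S0 δ) (T := T δ) h.2.1.2.1 h.2.1.2.2 htwo hthree hlam' h.2.2 rfl rfl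
  -- the family for the chord `(x₀, x₁)`
  obtain ⟨A₁, B₁, hfam₁, hid₁⟩ := zdDiscretisationFamily_of_labelling_arcs (D.chord 0 1 (by decide)) S0 T e het
    (hgood.mono fun δ h => h.1) (by
      have hup : Tendsto (fun δ => ENNReal.ofReal (e δ)) (𝓝[>] 0) (𝓝 0) := by
        rw [← ENNReal.ofReal_zero]; exact ENNReal.tendsto_ofReal het
      exact tendsto_of_tendsto_of_tendsto_of_le_of_le' tendsto_const_nhds hup
        (Eventually.of_forall fun _ => zero_le) (hgood.mono fun δ h => h.2.1))
  -- the family for the chord `(x₀, x₂)`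
  obtain ⟨A₂, B₂, hfam₂, hid₂⟩ := zdDiscretisationFamily_of_labelling_arcs (D.chord 0 2 (by decide)) SA SB ε hε
    (hlab.mono fun δ h => h.2.1.1) (by
      have hup : Tendsto (fun δ => ENNReal.ofReal (ε δ)) (𝓝[>] 0) (𝓝 0) := by
        rw [← ENNReal.ofReal_zero]; exact ENNReal.tendsto_ofReal hε
      exact tendsto_of_tendsto_of_tendsto_of_le_of_le' tendsto_const_nhds hup
        (Eventually.of_forall fun _ => zero_le) (hlab.mono fun δ h => h.2.1.2))
  refine ⟨A₁, B₁, A₂, B₂, e, hfam₁, hfam₂, het, ?_⟩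
  filter_upwards [hgood, hid₁, hid₂] with δ hg h1 h2
  obtain ⟨-, -, hS0A, hSBT, hΔ, ea, eb, e1, hAB, hAB01, hea, heb, he1⟩ := hg
  have hA1 : (⟨D.carrier, δ, A₁ δ, B₁ δ⟩ : DiscreteDobrushin).zdArcA = S0 δ := h1.1
  have hB1 : (⟨D.carrier, δ, A₁ δ, B₁ δ⟩ : DiscreteDobrushin).zdArcB = T δ := h1.2
  have hA2 : (⟨D.carrier, δ, A₂ δ, B₂ δ⟩ : DiscreteDobrushin).zdArcA = SA δ := h2.1
  have hB2 : (⟨D.carrier, δ, A₂ δ, B₂ δ⟩ : DiscreteDobrushin).zdArcB = SB δ := h2.2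
  have hE2 : (⟨D.carrier, δ, A₂ δ, B₂ δ⟩ : DiscreteDobrushin).zdABEdges =
      {e | e ∈ (discreteDomainGraph D.carrier δ).edgeSet ∧ (∃ x ∈ e, x ∈ SA δ) ∧ ∃ y ∈ e, y ∈ SB δ} := by
    ext x
    rw [DiscreteDobrushin.mem_zdABEdges_iff, hA2, hB2]
    rfl
  have hE1 : (⟨D.carrier, δ, A₁ δ, B₁ δ⟩ : DiscreteDobrushin).zdABEdges =
      {e | e ∈ (discreteDomainGraph D.carrier δ).edgeSet ∧ (∃ x ∈ e, x ∈ S0 δ) ∧ ∃ y ∈ e, y ∈ T δ} := by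
    ext x
    rw [DiscreteDobrushin.mem_zdABEdges_iff, hA1, hB1]
    rfl
  refine ⟨by rw [hA1, hA2]; exact hS0A, by rw [hB1, hB2]; exact hSBT, fun y hy hy' => ?_,
    ea, eb, e1, by rw [hE2, hAB], by rw [hE1, hAB01], hea, heb, he1⟩
  rw [hA2] at hy
  rw [hA1] at hy'
  exact hΔ y hy hy'

/-! ### Registered sub-goal (one-line signature, verbatim) -/

/-- **Registered sub-goal `stub_discreteSplitting_families` of `stub_discreteSplitting`**:
`splitting_families`, fully quantified. -/
theorem stub_discreteSplitting_families : ∀ D : MarkedDomain 3, ∃ (A₁ B₁ A₂ B₂ : ℝ → Set ℂ) (ε : ℝ → ℝ), ZdDiscretisationFamily (D.chord 0 1 (by decide)) (fun δ => (⟨D.carrier, δ, A₁ δ, B₁ δ⟩ : DiscreteDobrushin)) ∧ ZdDiscretisationFamily (D.chord 0 2 (by decide)) (fun δ => (⟨D.carrier, δ, A₂ δ, B₂ δ⟩ : DiscreteDobrushin)) ∧ Tendsto ε (𝓝[>] 0) (𝓝 0) ∧ ∀ᶠ δ in 𝓝[>] (0 : ℝ), (⟨D.carrier, δ, A₁ δ,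 B₁ δ⟩ : DiscreteDobrushin).zdArcA ⊆ (⟨D.carrier, δ, A₂ δ, B₂ δ⟩ : DiscreteDobrushin).zdArcA ∧ (⟨D.carrier, δ, A₂ δ, B₂ δ⟩ : DiscreteDobrushin).zdArcB ⊆ (⟨D.carrier, δ, A₁ δ, B₁ δ⟩ : DiscreteDobrushin).zdArcB ∧ (∀ y ∈ (⟨D.carrier, δ, A₂ δ, B₂ δ⟩ : DiscreteDobrushin).zdArcA, y ∉ (⟨D.carrier, δ, A₁ δ, B₁ δ⟩ : DiscreteDobrushin).zdArcA → Metric.infDist (meshPoint δ y) (D.arc 1) ≤ ε δ) ∧ ∃ ea eb e1 : Sym2 (Site 2), (⟨D.carrier, δ, A₂ δ, B₂ δ⟩ : DiscreteDobrushin).zdABEdges = {ea, eb} ∧ (⟨D.carrier, δ, A₁ δ, B₁ δ⟩ : DiscreteDobrushin).zdABEdges = {ea, e1} ∧ dist (medialPoint δ ea) (D.pt 0) ≤ ε δ ∧ dist (medialPoint δ eb) (D.pt 2) ≤ ε δ ∧ dist (medialPoint δ e1) (D.pt 1) ≤ ε δ :=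
  fun D => splitting_families D

/-! ### The stub -/

/-- **`stub_discreteSplitting` (R3b): exact lattice target independence.** See the module
docstring. -/
theorem stub_discreteSplitting : ∀ D : MarkedDomain 3, ∃ E₁ E₂ : ℝ → DiscreteDobrushin, ZdDiscretisationFamily (D.chord 0 1 (by decide)) E₁ ∧ ZdDiscretisationFamily (D.chord 0 2 (by decide)) E₂ ∧ ∀ ρ : ℝ, 0 < ρ → ∀ᶠ δ in nhdsWithin (0 : ℝ) (Set.Ioi 0), ∀ ω : BondConfig (Site 2), bondInterfaceIn (D.chord 0 1 (by decide)) (E₁ δ) ω = bondInterfaceIn (D.chord 0 2 (by decide)) (E₂ δ) ω ∨ ∃ (c c' : Curve ℂ) (s : unitInterval), CurveClass.mk c = bondInterfaceIn (D.chord 0 1 (by decide)) (E₁ δ) ω ∧ CurveClass.mk c' = bondInterfaceIn (D.chord 0 2 (by decide)) (E₂ δ) ω ∧ (∀ t : unitInterval, t ≤ s → c t = c' t) ∧ c s ∈ Metric.cthickening ρ (D.arc 1) := by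
  intro D
  obtain ⟨A₁, B₁, A₂, B₂, ε, hfam₁, hfam₂, hε, hgood⟩ := splitting_families D
  refine ⟨_, _, hfam₁, hfam₂, fun ρ hρ => ?_⟩
  have hx01 : 0 < dist (D.pt 0) (D.pt 1) := dist_pos.2 (D.pt_injective.ne (by decide))
  have hx02 : 0 < dist (D.pt 0) (D.pt 2) := dist_pos.2 (D.pt_injective.ne (by decide))
  have hx12 : 0 < dist (D.pt 1) (D.pt 2) := dist_pos.2 (D.pt_injective.ne (by decide))
  set c := min ρ (min (dist (D.pt 0) (D.pt 1) / 2) (min (dist (D.pt 0) (D.pt 2) / 2) (dist (D.pt 1) (D.pt 2) / 2)))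
    with hc
  have hc0 : 0 < c := by positivity
  have hsmall : ∀ᶠ δ in 𝓝[>] (0 : ℝ), ε δ + 2 * δ < c := by
    have h1 : Tendsto (fun δ : ℝ => ε δ + 2 * δ) (𝓝[>] 0) (𝓝 0) := by
      have hδ : Tendsto (fun δ : ℝ => δ) (𝓝[>] (0 : ℝ)) (𝓝 0) := tendsto_nhdsWithin_of_tendsto_nhds tendsto_id
      simpa using hε.add (hδ.const_mul 2)
    exact h1.eventually (gt_mem_nhds hc0)
  have hδpos : ∀ᶠ δ in 𝓝[>] (0 : ℝ), 0 < δ := self_mem_nhdsWithin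
  filter_upwards [hgood, hfam₁.eventually_isZdAdmissible, hfam₂.eventually_isZdAdmissible, hsmall, hδpos]
    with δ hg hE₁ hE₂ hs hδ ω
  obtain ⟨hA, hB, hΔ, ea, eb, e1, h2, h1, hea, heb, he1⟩ := hg
  have hcρ : c ≤ ρ := min_le_left _ _
  have hc01 : c ≤ dist (D.pt 0) (D.pt 1) / 2 := (min_le_right _ _).trans (min_le_left _ _)
  have hc02 : c ≤ dist (D.pt 0) (D.pt 2) / 2 := (min_le_right _ _).trans ((min_le_right _ _).trans (min_le_left _ _))
  have hc12 : c ≤ dist (D.pt 1) (D.pt 2) / 2 := (min_le_right _ _).trans ((min_le_right _ _).trans (min_le_right _ _))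
  -- the orientation inequalities
  have hoa1 : dist (medialPoint δ ea) (D.pt 0) ≤ dist (medialPoint δ ea) (D.pt 1) := by
    linarith [dist_triangle (D.pt 0) (medialPoint δ ea) (D.pt 1), dist_comm (D.pt 0) (medialPoint δ ea)]
  have hoa2 : dist (medialPoint δ ea) (D.pt 0) ≤ dist (medialPoint δ ea) (D.pt 2) := by
    linarith [dist_triangle (D.pt 0) (medialPoint δ ea) (D.pt 2), dist_comm (D.pt 0) (medialPoint δ ea)]
  have hob : dist (medialPoint δ eb) (D.pt 2) < dist (medialPoint δ eb) (D.pt 0) := by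
    linarith [dist_triangle (D.pt 0) (medialPoint δ eb) (D.pt 2), dist_comm (D.pt 0) (medialPoint δ eb)]
  have ho1 : dist (medialPoint δ e1) (D.pt 1) < dist (medialPoint δ e1) (D.pt 0) := by
    linarith [dist_triangle (D.pt 0) (medialPoint δ e1) (D.pt 1), dist_comm (D.pt 0) (medialPoint δ e1)]
  rcases splitting_at_mesh D hδ.le hE₁ hE₂ hA hB h2 h1 hoa1 hoa2 hob ho1 hΔ ω with h | ⟨c₁, c₂, s, h₁, h₂, h₃, h₄⟩
  · exact Or.inl h
  · exact Or.inr ⟨c₁, c₂, s, h₁, h₂, h₃, Metric.cthickening_mono (by linarith) _ h₄⟩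

end Summit.CriticalPhenomena.CardyFormulaZ2.Cruxes.LagHandOff.HittingTournament

end
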